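import Summits.QuantumFields.GaugeBoot.ClassBStrongCouplingAllGroups
import Summits.QuantumFields.GaugeBoot.DiagonalRPTorusClosedHalfNegativeThreeUniform
import Summits.QuantumFields.GaugeBoot.DiagonalRPTorusNegativeHighDimUniform
import HarnessLib

/-!
# Diagonal RP at strong coupling, every compact gauge group: every torus fails, every torus limit point succeeds (gauge-boot, L3 supplement)

HONEST FRAMING (cell `pub-gaugeboot`, page 1 of every file): the venture produces certified bounds
on lattice expectations at stated coupling, gauge group, dimension and torus size; NOT a mass gap,
NOT a continuum limit, NOT a string tension; NOT Yang–Mills-summit-bearing (barriers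
`FixedCouplingUltralocality`, `PerturbativeInvisibility`). This module is a STRONG-COUPLING
statement about lattice states, for citation; nothing is claimed at the couplings of the cell's
certificates.

## Content

The companion of `DiagonalRPTorusStrongCouplingContrast` (`SU(N)`, via Shen–Zhu–Zhu) for the
venture's other gauge group family and for a general compact group, now that Class B at strong
coupling is available for EVERY compact metrisable `G` (`thermodynamicLimitIsClassB_allGroups`,
Dobrushin uniqueness of the cell `pub-ymgap` at `6(d-1) N β < 1`):

* ★ **`tori_fail_limit_holds_diagRP_three_uN`** / **`_highDim_uN`** — `U(N)`, `N ≥ 1`, `d = 3` /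
  `d ≥ 4`: one `β₁ = β₁(d, N) > 0` such that for every `0 < β ≤ β₁` (a) NO torus `(ℤ/L)^d`,
  `L ≥ 3`, is diagonal-RP across `x₀ = x₁` (closed half for odd `L`, inner half for even `L`;
  gens 45/47's uniform windows `diagonalRP_fails_three_uniform_uN`, `diagonalRP_fails_uN_uniform`),
  YET (b) `TorusLimitPointsDiagonalRP d (unitaryFundamentalRep (Fin N) ℂ) β` — every infinite-volume
  limit point of these torus states is reflection positive in every diagonal hyperplane;
* **`torusLimitPointsDiagonalRP_allGroups`** — (b) alone for every compact metrisable `G` (in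
  `Type`), continuous `ρ`, `0 ≤ β`, `6(d-1) N β < 1`.

So for `U(N)` as for `SU(N)` the diagonal-RP obstruction on the tori at small coupling is a pure
finite-volume effect. Nothing outside the uniqueness window.
-/

noncomputable section

open MeasureTheory
open scoped ComplexConjugate ComplexOrder
open Literature.MathematicalPhysics.QuantumLattice

namespace Summit.QuantumFields.GaugeBoot

/-- **(b) for every compact group**: for compact metrisable `G`, continuous `ρ`, `0 ≤ β` with
`6(d-1) N β < 1`, every infinite-volume limit point of the torus Wilson states is reflection positive
in every diagonal hyperplane `x_i = x_j` (it is a Class-B state). [folklore] -/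
theorem torusLimitPointsDiagonalRP_allGroups {d N : ℕ} [NeZero d] {G : Type} [Group G]
    [TopologicalSpace G] [IsTopologicalGroup G] [CompactSpace G] [MeasurableSpace G] [BorelSpace G]
    [T2Space G] [SecondCountableTopology G] (ρ : G →* Matrix (Fin N) (Fin N) ℂ) (hρ : Continuous ρ)
    {β : ℝ} (hβ0 : 0 ≤ β) (hβ : 6 * ((d - 1 : ℕ) : ℝ) * N * β < 1) :
    TorusLimitPointsDiagonalRP d ρ β :=
  torusLimitPointsDiagonalRP_of_thermodynamicLimitIsClassB ρ
    (thermodynamicLimitIsClassB_allGroups ρ hρ hβ0 hβ)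

variable {N : ℕ}

/-- Couplings `β ≤ 1/(12(d-1)N + 1)` satisfy the Dobrushin condition `6(d-1) N β < 1`. [folklore] -/
theorem dobrushin_of_le_window {d : ℕ} {β : ℝ} (hβ : 0 < β)
    (hβ1 : β ≤ 1 / (12 * ((d - 1 : ℕ) : ℝ) * N + 1)) : 6 * ((d - 1 : ℕ) : ℝ) * N * β < 1 := by
  have hD0 : (0 : ℝ) ≤ 6 * ((d - 1 : ℕ) : ℝ) * N := by positivity
  have hW : (0 : ℝ) < 12 * ((d - 1 : ℕ) : ℝ) * N + 1 := by positivity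
  rw [le_div_iff₀ hW] at hβ1
  nlinarith

/-- ★ **THE CONTRAST IN `d = 3` for `U(N)` (`N ≥ 1`).** There is `β₁ = β₁(N) > 0` such that for
every `0 < β ≤ β₁`: (a) on EVERY cubic three-torus `(ℤ/L)^3`, `L ≥ 3`, diagonal reflection
positivity across `x₀ = x₁` FAILS for the `U(N)` Wilson theory (closed half for odd `L`, inner half
for even `L`), YET (b) every infinite-volume limit point of these torus states IS reflection positive
in every diagonal hyperplane (the unique DLR state is a Class-B state). [folklore] -/
theorem tori_fail_limit_holds_diagRP_three_uN (hN : 1 ≤ N) :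
    ∃ β₁ : ℝ, 0 < β₁ ∧ ∀ β : ℝ, 0 < β → β ≤ β₁ →
      (∀ (L : ℕ) [NeZero L], 3 ≤ L →
        (Odd L → ¬ DiagonalReflectionPositive (d := 3) (L := L) (unitaryFundamentalRep (Fin N) ℂ) β 0 1) ∧
          (Even L → ¬ InnerDiagonalRP (d := 3) (L := L) (unitaryFundamentalRep (Fin N) ℂ) β 0 1)) ∧
      TorusLimitPointsDiagonalRP 3 (unitaryFundamentalRep (Fin N) ℂ) β := by
  haveI : SecondCountableTopology (Matrix (Fin N) (Fin N) ℂ) :=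
    inferInstanceAs (SecondCountableTopology (Fin N → Fin N → ℂ))
  haveI : SecondCountableTopology (Matrix.unitaryGroup (Fin N) ℂ) :=
    Topology.IsEmbedding.subtypeVal.secondCountableTopology
  obtain ⟨β₀, hβ₀, htor⟩ := DiagRPHex.diagonalRP_fails_three_uniform_uN hN
  refine ⟨min β₀ (1 / (12 * ((3 - 1 : ℕ) : ℝ) * N + 1)), lt_min hβ₀ (by positivity),
    fun β hβ hβ1 => ⟨fun L _ hL => htor L hL β hβ (hβ1.trans (min_le_left _ _)), ?_⟩⟩
  exact torusLimitPointsDiagonalRP_allGroups (unitaryFundamentalRep (Fin N) ℂ)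
    (Literature.MathematicalPhysics.QuantumFieldTheory.isUnitaryModel_unitaryFundamentalRep N).1 hβ.le
    (dobrushin_of_le_window hβ (hβ1.trans (min_le_right _ _)))

/-- ★ **THE CONTRAST IN `d ≥ 4` for `U(N)` (`N ≥ 1`).** One `β₁ = β₁(d, N) > 0` such that for every
`0 < β ≤ β₁` every torus `(ℤ/L)^d`, `L ≥ 3`, fails diagonal RP across `x₀ = x₁` while every torus
limit point is diagonal-RP in every plane. [folklore] -/
theorem tori_fail_limit_holds_diagRP_highDim_uN {d : ℕ} (hd : 4 ≤ d) (hN : 1 ≤ N) :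
    ∃ β₁ : ℝ, 0 < β₁ ∧ ∀ β : ℝ, 0 < β → β ≤ β₁ →
      (∀ (L : ℕ) [NeZero L], 3 ≤ L →
        (Odd L → ¬ DiagonalReflectionPositive (d := d) (L := L) (unitaryFundamentalRep (Fin N) ℂ) β
            ⟨0, by omega⟩ ⟨1, by omega⟩) ∧
          (Even L → ¬ InnerDiagonalRP (d := d) (L := L) (unitaryFundamentalRep (Fin N) ℂ) β
            ⟨0, by omega⟩ ⟨1, by omega⟩)) ∧
      TorusLimitPointsDiagonalRP d (unitaryFundamentalRep (Fin N) ℂ) β := by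
  haveI : NeZero d := ⟨by omega⟩
  haveI : SecondCountableTopology (Matrix (Fin N) (Fin N) ℂ) :=
    inferInstanceAs (SecondCountableTopology (Fin N → Fin N → ℂ))
  haveI : SecondCountableTopology (Matrix.unitaryGroup (Fin N) ℂ) :=
    Topology.IsEmbedding.subtypeVal.secondCountableTopology
  obtain ⟨β₀, hβ₀, htor⟩ := DiagRPUnif.diagonalRP_fails_uN_uniform hd hN
  refine ⟨min β₀ (1 / (12 * ((d - 1 : ℕ) : ℝ) * N + 1)), lt_min hβ₀ (by positivity),
    fun β hβ hβ1 => ⟨fun L _ hL => htor L hL β hβ (hβ1.trans (min_le_left _ _)), ?_⟩⟩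
  exact torusLimitPointsDiagonalRP_allGroups (unitaryFundamentalRep (Fin N) ℂ)
    (Literature.MathematicalPhysics.QuantumFieldTheory.isUnitaryModel_unitaryFundamentalRep N).1 hβ.le
    (dobrushin_of_le_window hβ (hβ1.trans (min_le_right _ _)))

end Summit.QuantumFields.GaugeBoot

end
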